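import Mathlib
import Summits.Ventures.HodgeRepro2.T5CharacterAnnihilator

/-!
# The conductor-one Gauss sum over a quadratic extension of finite fields equals `q`
  (Lemma N5.L4(iii), case `a = 1`)

Lemma N5.L4(iii) of `route/TIER5.md` §N5.11.4, case `a = 1`: «`G := Σ_{x ∈ k_E^×} ξ̄^{-1}(x)ψ̄(x)`.
Group the sum by the cosets of `k_F^×` (`ξ̄` is constant on them): … `Σ_{f ∈ k_F^×} ψ̄(fy) =
q·[y ∈ L] − 1` … Therefore `G = q·ξ̄^{-1}(y₀) − Σ_{y ∈ Y} ξ̄^{-1}(y) = q − 0 = q` (the sum over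
the group `k_E^×/k_F^×` of the non-trivial character `ξ̄^{-1}` vanishes)». Checked here for
finite fields `F ⊆ E` with `[E : F] = 2`, a non-trivial additive character `ψ` of `E` trivial
on `F`, and a non-trivial character `χ` of `E^×` trivial on `F^×` (the prose's `ξ̄^{-1}`):

* `sum_mul_smul_eq`: reindexing by a base unit `f` leaves the sum invariant, so
  `|F^×| · G = Σ_x χ(x) Σ_{f ∈ F^×} ψ(f x)` (no cosets needed);
* `sum_units_smul_eq`: `Σ_{f ∈ F^×} ψ(f x) = |F|·[x ∈ F] − 1` (`T5CharacterAnnihilator`);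
* `sum_units_eq_zero`: `Σ_{x ∈ E^×} χ(x) = 0` (Mathlib's `sum_hom_units_eq_zero`) and
  `sum_base_units`: `Σ_{x ∈ E^×, x ∈ F} χ(x) = |F^×|`;
* `gauss_sum_eq_card`: `G = |F|` — the value `q` of the prose.

Declaration per README §8(d): «uses an L-value-free non-vanishing device: NO».
-/

namespace Summit.Ventures.HodgeRepro2.T5ConductorOneGaussSum

open T5CharacterAnnihilator

variable {F E : Type*} [Field F] [Field E] [Algebra F E] [Fintype F] [DecidableEq F] [Fintype E]
  [DecidableEq E]

/-- The base units inside `Eˣ`. -/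
abbrev baseUnits : Fˣ →* Eˣ := Units.map (algebraMap F E : F →* E)

omit [Fintype F] [DecidableEq F] in
/-- Reindexing by a base unit: `Σ_x χ(x) ψ(x) = Σ_x χ(x) ψ(f • x)` when `χ` is trivial on the
base units. -/
theorem sum_mul_smul_eq (χ : Eˣ →* ℂˣ) (hχF : ∀ u : Fˣ, χ (baseUnits u) = 1) (ψ : AddChar E ℂ)
    (f : Fˣ) :
    ∑ x : Eˣ, ((χ x : ℂˣ) : ℂ) * ψ x = ∑ x : Eˣ, ((χ x : ℂˣ) : ℂ) * ψ ((f : F) • (x : E)) := by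
  rw [← Equiv.sum_comp (Equiv.mulLeft (baseUnits f)) (fun x : Eˣ => ((χ x : ℂˣ) : ℂ) * ψ x)]
  refine Finset.sum_congr rfl fun x _ => ?_
  simp only [Equiv.coe_mulLeft, map_mul, hχF, one_mul, Units.val_mul]
  congr 2
  rw [Algebra.smul_def]
  rfl

omit [Fintype E] [DecidableEq E] in
/-- `Σ_{f ∈ Fˣ} ψ(f • x) = Σ_{f ∈ F} ψ(f • x) − 1`. -/
theorem sum_units_smul_eq_sub (ψ : AddChar E ℂ) (x : E) :
    ∑ f : Fˣ, ψ ((f : F) • x) = (∑ f : F, ψ (f • x)) - 1 := by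
  classical
  rw [Fintype.sum_eq_add_sum_compl (0 : F), zero_smul, AddChar.map_zero_eq_one, add_sub_cancel_left]
  have e : ({0}ᶜ : Finset F) = Finset.univ.image (Units.val : Fˣ → F) := by
    ext a
    simp only [Finset.mem_compl, Finset.mem_singleton, Finset.mem_image, Finset.mem_univ, true_and]
    constructor
    · intro ha
      exact ⟨Units.mk0 a ha, rfl⟩
    · rintro ⟨u, rfl⟩
      exact u.ne_zero
  rw [e, Finset.sum_image (fun u _ v _ h => Units.val_injective h)]

omit [Fintype E] in
/-- The inner sum: `Σ_{f ∈ Fˣ} ψ(f • x) = |F|·[x ∈ F] − 1` for `ψ` non-trivial and trivial on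
`F`, `[E : F] = 2`. -/
theorem sum_units_smul_eq (hdim : Module.finrank F E = 2) (ψ : AddChar E ℂ)
    (hψF : ∀ f : F, ψ (algebraMap F E f) = 1) (hψ : ψ ≠ 1) (x : E) :
    ∑ f : Fˣ, ψ ((f : F) • x) =
      (if x ∈ Set.range (algebraMap F E) then (Fintype.card F : ℂ) else 0) - 1 := by
  classical
  rw [sum_units_smul_eq_sub]
  have hsum := sum_smul_eq (F := F) ψ x
  rw [hsum]
  have hψe : ∀ f : F, ψ (f • (1 : E)) = 1 := fun f => by
    rw [← Algebra.algebraMap_eq_smul_one]; exact hψF f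
  have hL : (annihilator ψ : Submodule F E) = F ∙ (1 : E) :=
    annihilator_eq_span hdim ψ one_ne_zero hψe hψ
  have hmem : x ∈ (annihilator ψ : Submodule F E) ↔ x ∈ Set.range (algebraMap F E) := by
    rw [hL, Submodule.mem_span_singleton]
    constructor
    · rintro ⟨a, rfl⟩
      exact ⟨a, Algebra.algebraMap_eq_smul_one a⟩
    · rintro ⟨a, rfl⟩
      exact ⟨a, (Algebra.algebraMap_eq_smul_one a).symm⟩
  simp only [hmem]

/-- A non-trivial character of `Eˣ` sums to `0` (Mathlib's `sum_hom_units_eq_zero`). -/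
theorem sum_units_eq_zero (χ : Eˣ →* ℂˣ) (hχ : χ ≠ 1) : ∑ x : Eˣ, ((χ x : ℂˣ) : ℂ) = 0 := by
  have h : ((Units.coeHom ℂ).comp χ : Eˣ →* ℂ) ≠ 1 := by
    intro h
    apply hχ
    ext x
    have := DFunLike.congr_fun h x
    simpa using this
  exact sum_hom_units_eq_zero _ h

/-- The base units contribute `|Fˣ|`: `Σ_{x ∈ Eˣ, x ∈ F} χ(x) = |Fˣ|` for `χ` trivial on the base
units. -/
theorem sum_base_units (χ : Eˣ →* ℂˣ) (hχF : ∀ u : Fˣ, χ (baseUnits u) = 1) :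
    ∑ x : Eˣ, (if (x : E) ∈ Set.range (algebraMap F E) then ((χ x : ℂˣ) : ℂ) else 0) =
      Fintype.card Fˣ := by
  classical
  rw [← Finset.sum_filter]
  have hinj : Function.Injective (baseUnits : Fˣ →* Eˣ) :=
    Units.map_injective (algebraMap F E).injective
  have e : (Finset.univ.filter fun x : Eˣ => (x : E) ∈ Set.range (algebraMap F E)) =
      Finset.univ.image (baseUnits : Fˣ → Eˣ) := by
    ext x
    simp only [Finset.mem_filter, Finset.mem_univ, true_and, Finset.mem_image]
    constructor
    · rintro ⟨a, ha⟩
      have ha0 : a ≠ 0 := by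
        rintro rfl
        exact x.ne_zero (by rw [← ha, map_zero])
      exact ⟨Units.mk0 a ha0, Units.ext (by simpa using ha)⟩
    · rintro ⟨u, rfl⟩
      exact ⟨u, rfl⟩
  rw [e, Finset.sum_image (fun u _ v _ h => hinj h)]
  simp [hχF]

/-- THE CONDUCTOR-ONE GAUSS SUM: for finite fields `F ⊆ E` with `[E : F] = 2`, `ψ` a non-trivial
additive character of `E` trivial on `F`, and `χ` a non-trivial character of `Eˣ` trivial on the
base units, `Σ_{x ∈ Eˣ} χ(x) ψ(x) = |F|` (the prose's `G = q`). -/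
theorem gauss_sum_eq_card (hdim : Module.finrank F E = 2) (ψ : AddChar E ℂ)
    (hψF : ∀ f : F, ψ (algebraMap F E f) = 1) (hψ : ψ ≠ 1) (χ : Eˣ →* ℂˣ)
    (hχF : ∀ u : Fˣ, χ (baseUnits u) = 1) (hχ : χ ≠ 1) :
    ∑ x : Eˣ, ((χ x : ℂˣ) : ℂ) * ψ x = Fintype.card F := by
  classical
  -- `|Fˣ| · S = Σ_x χ(x) Σ_f ψ(f • x)`
  have hcard : (Fintype.card Fˣ : ℂ) ≠ 0 := by
    exact_mod_cast Fintype.card_ne_zero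
  apply mul_left_cancel₀ hcard
  have h1 : ∑ f : Fˣ, ∑ x : Eˣ, ((χ x : ℂˣ) : ℂ) * ψ ((f : F) • (x : E)) =
      (Fintype.card Fˣ : ℂ) * ∑ x : Eˣ, ((χ x : ℂˣ) : ℂ) * ψ x := by
    rw [Finset.sum_congr rfl (fun f _ => (sum_mul_smul_eq χ hχF ψ f).symm), Finset.sum_const,
      Finset.card_univ, nsmul_eq_mul]
  rw [← h1, Finset.sum_comm]
  simp_rw [← Finset.mul_sum]
  have h2 : ∀ x : Eˣ, ((χ x : ℂˣ) : ℂ) * ∑ f : Fˣ, ψ ((f : F) • (x : E)) =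
      (Fintype.card F : ℂ) *
        (if (x : E) ∈ Set.range (algebraMap F E) then ((χ x : ℂˣ) : ℂ) else 0) -
        ((χ x : ℂˣ) : ℂ) := by
    intro x
    rw [sum_units_smul_eq hdim ψ hψF hψ]
    split_ifs <;> ring
  simp_rw [h2]
  rw [Finset.sum_sub_distrib, ← Finset.mul_sum, sum_base_units χ hχF, sum_units_eq_zero χ hχ,
    sub_zero]
  ring

end Summit.Ventures.HodgeRepro2.T5ConductorOneGaussSum
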